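import Mathlib
import Literature.Analysis.Calculus.CayleyTransform                       -- ★ `cayley`, `cayley_cayley`, `one_sub_cayley`, `isUnit_two`, `contDiffAt_cayley`
import HarnessLib

/-!
# The radial Cayley bump on `M₃(ℂ)`: `ψ(Y) = β(Σ|c(ζ⁻¹Y)_{ij}|²) · χ(Σ|(ζ⁻¹Y − 1)_{ij}|²)` — `Ad(U(3))`-invariance, ambient smoothness, support inside any
# prescribed neighbourhood of `ζ·1`, and `ψ(ζX) = β(Σ|c(X)_{ij}|²)` wherever `1 + X` is invertible

Topic `NumberTheory/Rogawski1990`; namespace `Literature.NumberTheory.Automorphic.UnitaryGroup` (matrix norms: `open scoped Matrix.Norms.Operator`, the house convention of ★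
`ArchRankTwoSplitReadingParabolic` ∕ ★ `ArchCentralLimitFormula`).  THEOREMS ONLY (no `def`, no instance, no notation, no axiom, no named fact, no `sorry`); the bump is the TERM
`Y ↦ β(Σ_{ij}|c(ζ⁻¹Y)_{ij}|²) · χ(Σ_{ij}|(ζ⁻¹Y − 1)_{ij}|²)` written out in every statement (`c` = ★ `Literature.Analysis.Calculus.cayley`, `c(X) = (1 − X)(1 + X)⁻¹`).
Cell `pub/hodgecm-mathlib`, crux H413 (`stmt-HodgeConjecture-24833`), half-A line LH2, road «N8-INNER», brick (10)(B) «CORNER EP GENERATOR, ONE PLACE» (RULING (10)′, SIGSHEET (B) v2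
3cdc6cba8e426222 «=» 16:35:25Z), seat F0P3a-p08 (g25), FILE D.  Consumer: FILE B `Rogawski1990/ArchRankTwoCentralGenerator` — the test function `f₀ = ψ ∘ Ad(T_w) ∘ ↑↑` on
`U(β₀)_w` whose split-chart reading vanishes near the scalar corner `ζ·1` (★ FILE C `ArchRankTwoCayleyFibreIntegral`, ★ FILE P `ShellNullProfile`).  Count-neutral.

THE MATHEMATICS.  `M₃(ℂ)` with the `L^∞`-operator norm `‖·‖` and the smooth Frobenius sum `q(M) = Σ_{ij}|M_{ij}|²` (`|M_{ij}| ≤ ‖M‖ ≤ Σ|M_{ij}| ≤ 9ε∕2 + q(M)∕(2ε)`, §1).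
(§2) If `q(X − 1) ≤ 1∕3` then `‖X − 1‖ < 2`, so `1 + X = 2(1 − ½(1 − X))` is a UNIT (Neumann series, Mathlib `Units.oneSub`); and if `1 + X` is a unit and `q(c(X)) ≤ η²∕3600`
(`0 < η ≤ 1`) then `q(X − 1) ≤ η∕2` — because `X = c(c(X))` (★ `cayley_cayley`), `1 − c(C) = 2C(1 + C)⁻¹` (★ `one_sub_cayley`) and `‖(1 + C)⁻¹‖ ≤ (1 − ‖C‖)⁻¹`.
(§3) `q(kMk⁻¹) = q(M)` for `k ∈ U(3)` (`q(M) = Re tr(MM^*)`) and `c(kMk⁻¹) = k c(M) k⁻¹` for invertible `k`.  (§4) THE BUMP `ψ(Y) = β(q(c(ζ⁻¹Y))) χ(q(ζ⁻¹Y − 1))`, `|ζ| = 1`: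
(a) `ψ(kYk⁻¹) = ψ(Y)` for `k ∈ U(3)` — the `Ad(K∞)`-invariance that makes the `K`-integral of ★ (K1) drop; (b) `ψ ∈ C^∞(M₃(ℂ))` for smooth `β, χ` with `χ ≡ 0` on `[η, ∞)`,
`η ≤ 1∕3`: on `{q(ζ⁻¹Y − 1) ≤ 1∕3}` the Cayley transform is smooth (★ `contDiffAt_cayley`), elsewhere the cut-off kills a neighbourhood; (c) `ψ(Y) ≠ 0 ⇒ ‖Y − ζ·1‖ < r` once
`η ≤ r²∕9`, so `ψ` has compact support inside any prescribed neighbourhood of `ζ·1`; (d) if moreover `χ ≡ 1` on `(−∞, η∕2]` and `β ≡ 0` on `[R₀, ∞)`, `R₀ ≤ η²∕3600`, then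
**`ψ(ζX) = β(q(c(X)))` for every `X` with `1 + X` invertible** — on the fibres `T·N` of the split torus (upper triangular, `1 + X` invertible) the test function IS the radial profile, so
★ FILE C's fibre integral applies verbatim.  [Weyl1939 Ch. II §10 (Cayley's parametrisation); Knapp2002 Introduction §2 (rational matrix calculus); Rogawski1990 §4.9 p. 55.]
HONEST LABEL: HC_CM is proved only modulo the 7 printed citations (2 remaining: hLiu418 = `stmt-HodgeConjecture-24832`, h413 = `stmt-HodgeConjecture-24833`) until rung 0 closes;
elementary matrix analysis for the in-house road of row 2 `stub_N8`, count-neutral (+0∕+0).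

* §1 `norm_entry_le_linfty_opNorm`, `linfty_opNorm_le_sum_norm`, `linfty_opNorm_le_of_sum_sq`, `sum_sq_le_sq_linfty_opNorm`;
* §2 **`isUnit_one_add_of_sum_sq_sub_one_le`**, **`sum_sq_sub_one_le_of_sum_sq_cayley_le`**;
* §3 `sum_norm_sq_eq_re_trace_mul_conjTranspose`, **`sum_norm_sq_unitary_conj`**, **`cayley_conj_eq`**;
* §4 **`radialCayleyBump_unitary_conj`**, `contDiffAt_sum_norm_sq_comp`, **`contDiff_radialCayleyBump`**, `norm_sub_lt_of_radialCayleyBump_ne_zero`,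
  **`hasCompactSupport_radialCayleyBump`**, **`radialCayleyBump_smul_eq_of_isUnit`**.

## References
* [Weyl1939] H. Weyl, *The Classical Groups, their Invariants and Representations*, Princeton (1939), Ch. II §10.
* [Knapp2002] A. W. Knapp, *Lie Groups Beyond an Introduction*, 2nd ed. (2002), Introduction §2.
* [Rogawski1990] J. D. Rogawski, *Automorphic Representations of Unitary Groups in Three Variables*, Ann. of Math. Stud. 123 (1990), §4.9 p. 55.
-/

set_option autoImplicit false

noncomputable section

open Set Filter Real Topology Metric Complex
open Literature.Analysis.Calculus (cayley cayley_def cayley_cayley one_sub_cayley one_add_cayley isUnit_one_add_cayley isUnit_two contDiffAt_cayley)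
open scoped ContDiff ComplexConjugate Matrix Matrix.Norms.Operator

namespace Literature.NumberTheory.Automorphic.UnitaryGroup

/-! ## §1 The `L^∞`-operator norm against the Frobenius sum `Σ|M_{ij}|²` -/

section Norms

variable {n : ℕ}

/-- `|M_{ij}| ≤ ‖M‖` (the `L^∞`-operator norm dominates every entry). [folklore] -/
private theorem norm_entry_le_linfty_opNorm (M : Matrix (Fin n) (Fin n) ℂ) (i j : Fin n) : ‖M i j‖ ≤ ‖M‖ := by
  rw [Matrix.linfty_opNorm_def]
  have h1 : ‖M i j‖₊ ≤ ∑ j', ‖M i j'‖₊ := Finset.single_le_sum (f := fun j' => ‖M i j'‖₊) (fun _ _ => bot_le) (Finset.mem_univ j)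
  have h2 : (∑ j', ‖M i j'‖₊) ≤ (Finset.univ : Finset (Fin n)).sup fun i' => ∑ j', ‖M i' j'‖₊ :=
    Finset.le_sup (f := fun i' => ∑ j', ‖M i' j'‖₊) (Finset.mem_univ i)
  exact_mod_cast h1.trans h2

/-- `‖M‖ ≤ Σ_{ij} |M_{ij}|`. [folklore] -/
private theorem linfty_opNorm_le_sum_norm (M : Matrix (Fin n) (Fin n) ℂ) : ‖M‖ ≤ ∑ i, ∑ j, ‖M i j‖ := by
  rw [Matrix.linfty_opNorm_def]
  have h : ((Finset.univ : Finset (Fin n)).sup fun i => ∑ j, ‖M i j‖₊) ≤ ∑ i, ∑ j, ‖M i j‖₊ :=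
    Finset.sup_le fun i _ => Finset.single_le_sum (f := fun i => ∑ j, ‖M i j‖₊) (fun _ _ => bot_le) (Finset.mem_univ i)
  have h' := NNReal.coe_le_coe.2 h
  simpa [NNReal.coe_sum] using h'

/-- `‖M‖ ≤ (n²ε)∕2 + (Σ_{ij}|M_{ij}|²)∕(2ε)` for every `ε > 0` (AM–GM on each entry). [folklore] -/
private theorem linfty_opNorm_le_of_sum_sq (M : Matrix (Fin n) (Fin n) ℂ) {ε : ℝ} (hε : 0 < ε) :
    ‖M‖ ≤ (n : ℝ) ^ 2 * ε / 2 + (∑ i, ∑ j, ‖M i j‖ ^ 2) / (2 * ε) := by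
  refine (linfty_opNorm_le_sum_norm M).trans ?_
  have hentry : ∀ i j, ‖M i j‖ ≤ ε / 2 + ‖M i j‖ ^ 2 / (2 * ε) := fun i j => by
    have h0 : 0 ≤ ‖M i j‖ := norm_nonneg _
    rw [div_add_div _ _ two_ne_zero (by positivity), le_div_iff₀ (by positivity)]
    nlinarith [sq_nonneg (‖M i j‖ - ε)]
  calc ∑ i, ∑ j, ‖M i j‖ ≤ ∑ i : Fin n, ∑ j : Fin n, (ε / 2 + ‖M i j‖ ^ 2 / (2 * ε)) :=
        Finset.sum_le_sum fun i _ => Finset.sum_le_sum fun j _ => hentry i j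
    _ = (n : ℝ) ^ 2 * ε / 2 + (∑ i, ∑ j, ‖M i j‖ ^ 2) / (2 * ε) := by
        simp only [Finset.sum_add_distrib, Finset.sum_const, Finset.card_univ, Fintype.card_fin, nsmul_eq_mul, Finset.sum_div]
        ring

/-- `Σ_{ij}|M_{ij}|² ≤ n² ‖M‖²`. [folklore] -/
private theorem sum_sq_le_sq_linfty_opNorm (M : Matrix (Fin n) (Fin n) ℂ) : ∑ i, ∑ j, ‖M i j‖ ^ 2 ≤ (n : ℝ) ^ 2 * ‖M‖ ^ 2 := by
  calc ∑ i, ∑ j, ‖M i j‖ ^ 2 ≤ ∑ i : Fin n, ∑ j : Fin n, ‖M‖ ^ 2 :=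
        Finset.sum_le_sum fun i _ => Finset.sum_le_sum fun j _ => pow_le_pow_left₀ (norm_nonneg _) (norm_entry_le_linfty_opNorm M i j) 2
    _ = (n : ℝ) ^ 2 * ‖M‖ ^ 2 := by
        simp only [Finset.sum_const, Finset.card_univ, Fintype.card_fin, nsmul_eq_mul]
        ring

end Norms

/-! ## §2 `1 + X` is invertible when `Σ|(X − 1)_{ij}|² ≤ 1∕3`, and `X − 1` is small when `c(X)` is -/

section Units

/-- **`Σ_{ij} |(X − 1)_{ij}|² ≤ 1∕3 ⇒ 1 + X` is a unit** of `M₃(ℂ)` (`‖X − 1‖ ≤ 9∕8 + 2∕3 < 2`, so `1 + X = 2(1 − ½(1 − X))` with `‖½(1 − X)‖ < 1`; Neumann series).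
[cite: Weyl1939, Ch. II §10] -/
theorem isUnit_one_add_of_sum_sq_sub_one_le (X : Matrix (Fin 3) (Fin 3) ℂ) (h : ∑ i, ∑ j, ‖(X - 1) i j‖ ^ 2 ≤ 1 / 3) : IsUnit (1 + X) := by
  have hn : ‖X - 1‖ < 2 := by
    have h1 := linfty_opNorm_le_of_sum_sq (X - 1) (ε := 1 / 4) (by norm_num)
    have : ((3 : ℕ) : ℝ) ^ 2 * (1 / 4) / 2 + (∑ i, ∑ j, ‖(X - 1) i j‖ ^ 2) / (2 * (1 / 4)) < 2 := by
      have : (∑ i, ∑ j, ‖(X - 1) i j‖ ^ 2) / (2 * (1 / 4)) ≤ (1 / 3) / (2 * (1 / 4)) := by gcongr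
      norm_num at this ⊢
      linarith
    exact h1.trans_lt this
  set t : Matrix (Fin 3) (Fin 3) ℂ := 1 - (1 / 2 : ℝ) • (1 + X) with ht
  have ht' : t = (1 / 2 : ℝ) • (1 - X) := by
    have h1 : (1 : Matrix (Fin 3) (Fin 3) ℂ) = (1 / 2 : ℝ) • (1 : Matrix (Fin 3) (Fin 3) ℂ) + (1 / 2 : ℝ) • (1 : Matrix (Fin 3) (Fin 3) ℂ) := by
      rw [← add_smul]; norm_num
    rw [ht, smul_sub, smul_add]
    nth_rewrite 1 [h1]
    abel
  have htn : ‖t‖ < 1 := by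
    rw [ht', norm_smul, Real.norm_eq_abs, abs_of_pos (by norm_num : (0 : ℝ) < 1 / 2), ← neg_sub, norm_neg]
    linarith
  have hu : IsUnit (1 - t) := (Units.oneSub t htn).isUnit
  have he : (1 : Matrix (Fin 3) (Fin 3) ℂ) + X = (2 : ℝ) • (1 - t) := by
    rw [show (1 : Matrix (Fin 3) (Fin 3) ℂ) - t = (1 / 2 : ℝ) • (1 + X) by rw [ht]; exact sub_sub_cancel _ _, smul_smul]
    norm_num
  rw [he, Algebra.smul_def]
  exact ((isUnit_iff_ne_zero.2 (two_ne_zero : (2 : ℝ) ≠ 0)).map (algebraMap ℝ (Matrix (Fin 3) (Fin 3) ℂ))).mul hu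

/-- **`c(X)` SMALL ⇒ `X − 1` SMALL**: for `1 + X` invertible, `0 < η ≤ 1` and `Σ|c(X)_{ij}|² ≤ η²∕3600`: `Σ|(X − 1)_{ij}|² ≤ η∕2`
(`X = c(c(X))`, `1 − c(C) = 2C(1+C)⁻¹`, `‖(1+C)⁻¹‖ ≤ (1 − ‖C‖)⁻¹`). [cite: Weyl1939, Ch. II §10] -/
theorem sum_sq_sub_one_le_of_sum_sq_cayley_le (X : Matrix (Fin 3) (Fin 3) ℂ) (hX : IsUnit (1 + X)) {η : ℝ} (hη : 0 < η) (hη1 : η ≤ 1)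
    (h : ∑ i, ∑ j, ‖(cayley X) i j‖ ^ 2 ≤ η ^ 2 / 3600) : ∑ i, ∑ j, ‖(X - 1) i j‖ ^ 2 ≤ η / 2 := by
  set C : Matrix (Fin 3) (Fin 3) ℂ := cayley X with hC
  -- `‖C‖ ≤ η∕40 + η∕40`
  have hCn : ‖C‖ ≤ η / 20 := by
    have h1 := linfty_opNorm_le_of_sum_sq C (ε := η / 180) (by positivity)
    have h2 : (∑ i, ∑ j, ‖C i j‖ ^ 2) / (2 * (η / 180)) ≤ (η ^ 2 / 3600) / (2 * (η / 180)) := by gcongr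
    have h3 : (η ^ 2 / 3600) / (2 * (η / 180)) = η / 40 := by field_simp; ring
    have h4 : ((3 : ℕ) : ℝ) ^ 2 * (η / 180) / 2 = η / 40 := by norm_num; ring
    linarith [h1, h2]
  have hC1 : ‖C‖ < 1 := by linarith
  have hCneg : ‖-C‖ < 1 := by rwa [norm_neg]
  -- `X − 1 = −(1 − c(C)) = −2C(1+C)⁻¹`
  have hXC : X = cayley C := by rw [hC, cayley_cayley hX]
  have h1C : IsUnit (1 + C) := by rw [hC]; exact isUnit_one_add_cayley hX
  have hinvn : ‖Ring.inverse (1 + C)‖ ≤ (1 - ‖C‖)⁻¹ := by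
    have e := geom_series_eq_inverse (-C) hCneg
    rw [sub_neg_eq_add] at e
    rw [← e]
    have h' := tsum_geometric_le_of_norm_lt_one (-C) hCneg
    rw [norm_one, norm_neg, sub_self, zero_add] at h'
    exact h'
  have hX1 : ‖X - 1‖ ≤ 2 * ‖C‖ * (1 - ‖C‖)⁻¹ := by
    have e : X - 1 = -(2 * C * Ring.inverse (1 + C)) := by rw [← one_sub_cayley h1C, ← hXC, neg_sub]
    rw [e, norm_neg]
    calc ‖2 * C * Ring.inverse (1 + C)‖ ≤ ‖(2 : Matrix (Fin 3) (Fin 3) ℂ) * C‖ * ‖Ring.inverse (1 + C)‖ := norm_mul_le _ _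
      _ ≤ (2 * ‖C‖) * (1 - ‖C‖)⁻¹ := by
          gcongr
          · calc ‖(2 : Matrix (Fin 3) (Fin 3) ℂ) * C‖ ≤ ‖(2 : Matrix (Fin 3) (Fin 3) ℂ)‖ * ‖C‖ := norm_mul_le _ _
              _ ≤ 2 * ‖C‖ := by
                  gcongr
                  rw [show (2 : Matrix (Fin 3) (Fin 3) ℂ) = 1 + 1 by norm_num]
                  exact (norm_add_le _ _).trans (by rw [norm_one]; norm_num)
  -- `‖X − 1‖ ≤ η∕5`, hence `Σ|(X−1)_{ij}|² ≤ 9 (η∕5)² ≤ η∕2`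
  have hX1' : ‖X - 1‖ ≤ η / 5 := by
    have hden : (1 - ‖C‖)⁻¹ ≤ 2 := by
      rw [inv_le_comm₀ (by linarith) two_pos]
      linarith
    calc ‖X - 1‖ ≤ 2 * ‖C‖ * (1 - ‖C‖)⁻¹ := hX1
      _ ≤ 2 * (η / 20) * 2 := by gcongr
      _ = η / 5 := by ring
  calc ∑ i, ∑ j, ‖(X - 1) i j‖ ^ 2 ≤ ((3 : ℕ) : ℝ) ^ 2 * ‖X - 1‖ ^ 2 := sum_sq_le_sq_linfty_opNorm (X - 1)
    _ ≤ 9 * (η / 5) ^ 2 := by norm_num; gcongr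
    _ ≤ η / 2 := by nlinarith

end Units


/-! ## §3 Invariance under unitary conjugation: the Frobenius sum and the Cayley transform -/

section Invariance

/-- `Σ_{ij} |M_{ij}|² = Re tr(M M^*)`. [folklore] -/
private theorem sum_norm_sq_eq_re_trace_mul_conjTranspose (M : Matrix (Fin 3) (Fin 3) ℂ) :
    ∑ i, ∑ j, ‖M i j‖ ^ 2 = (Matrix.trace (M * Mᴴ)).re := by
  simp only [Matrix.trace, Matrix.diag, Matrix.mul_apply, Matrix.conjTranspose_apply, Complex.re_sum, RCLike.star_def,
    Complex.mul_conj, Complex.ofReal_re, Complex.normSq_eq_norm_sq]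

/-- **The Frobenius sum is invariant under unitary conjugation**: `Σ|(kMk⁻¹)_{ij}|² = Σ|M_{ij}|²` for `k ∈ U(3)`. [folklore] -/
private theorem sum_norm_sq_unitary_conj (k : Matrix (Fin 3) (Fin 3) ℂ) (hk : k ∈ Matrix.unitaryGroup (Fin 3) ℂ) (M : Matrix (Fin 3) (Fin 3) ℂ) :
    ∑ i, ∑ j, ‖(k * M * k⁻¹) i j‖ ^ 2 = ∑ i, ∑ j, ‖M i j‖ ^ 2 := by
  have h1 : k * star k = 1 := Matrix.mem_unitaryGroup_iff.1 hk
  have h2 : star k * k = 1 := Matrix.mem_unitaryGroup_iff'.1 hk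
  have hinv : k⁻¹ = star k := Matrix.inv_eq_right_inv h1
  rw [sum_norm_sq_eq_re_trace_mul_conjTranspose, sum_norm_sq_eq_re_trace_mul_conjTranspose, hinv]
  have e : k * M * star k * (k * M * star k)ᴴ = k * (M * Mᴴ) * star k := by
    rw [Matrix.conjTranspose_mul, Matrix.conjTranspose_mul, Matrix.star_eq_conjTranspose, Matrix.conjTranspose_conjTranspose]
    calc k * M * kᴴ * (k * (Mᴴ * kᴴ)) = k * M * (kᴴ * k) * Mᴴ * kᴴ := by
          simp only [Matrix.mul_assoc]
      _ = k * (M * Mᴴ) * kᴴ := by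
          rw [show kᴴ * k = 1 from by rw [← Matrix.star_eq_conjTranspose]; exact h2, Matrix.mul_one]
          simp only [Matrix.mul_assoc]
  rw [e, Matrix.trace_mul_cycle, show star k * k = 1 from h2, Matrix.one_mul]

/-- **The Cayley transform commutes with conjugation**: `c(kMk⁻¹) = k c(M) k⁻¹` for invertible `k` (★ `cayley` with Mathlib's matrix inverse, `(AB)⁻¹ = B⁻¹A⁻¹` unconditionally).
[cite: Weyl1939, Ch. II §10] -/
theorem cayley_conj_eq (k M : Matrix (Fin 3) (Fin 3) ℂ) (hk : IsUnit k.det) : cayley (k * M * k⁻¹) = k * cayley M * k⁻¹ := by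
  have hkk : k * k⁻¹ = 1 := Matrix.mul_nonsing_inv k hk
  have hkk' : k⁻¹ * k = 1 := Matrix.nonsing_inv_mul k hk
  have hp : (1 : Matrix (Fin 3) (Fin 3) ℂ) + k * M * k⁻¹ = k * (1 + M) * k⁻¹ := by
    rw [Matrix.mul_add, Matrix.add_mul, Matrix.mul_one, hkk]
  have hm : (1 : Matrix (Fin 3) (Fin 3) ℂ) - k * M * k⁻¹ = k * (1 - M) * k⁻¹ := by
    rw [Matrix.mul_sub, Matrix.sub_mul, Matrix.mul_one, hkk]
  rw [cayley_def, cayley_def, ← Matrix.nonsing_inv_eq_ringInverse, ← Matrix.nonsing_inv_eq_ringInverse, hp, hm, Matrix.mul_inv_rev,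
    Matrix.mul_inv_rev, Matrix.nonsing_inv_nonsing_inv k hk]
  calc k * (1 - M) * k⁻¹ * (k * ((1 + M)⁻¹ * k⁻¹)) = k * (1 - M) * (k⁻¹ * k) * (1 + M)⁻¹ * k⁻¹ := by simp only [Matrix.mul_assoc]
    _ = k * ((1 - M) * (1 + M)⁻¹) * k⁻¹ := by rw [hkk', Matrix.mul_one]; simp only [Matrix.mul_assoc]

end Invariance

/-! ## §4 The radial Cayley bump: invariance, smoothness, support, and its value on `{1 + X invertible}` -/

section Bump

variable (β χ : ℝ → ℝ) (ζ : ℂ)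

/-- **`Ad(U(3))`-INVARIANCE**: `ψ(kYk⁻¹) = ψ(Y)` for `k ∈ U(3)`, `ψ(Y) = β(Σ|c(ζ⁻¹Y)_{ij}|²) χ(Σ|(ζ⁻¹Y − 1)_{ij}|²)`. [cite: Weyl1939, Ch. II §10] -/
theorem radialCayleyBump_unitary_conj (k : Matrix (Fin 3) (Fin 3) ℂ) (hk : k ∈ Matrix.unitaryGroup (Fin 3) ℂ) (Y : Matrix (Fin 3) (Fin 3) ℂ) :
    β (∑ i, ∑ j, ‖cayley (ζ⁻¹ • (k * Y * k⁻¹)) i j‖ ^ 2) * χ (∑ i, ∑ j, ‖(ζ⁻¹ • (k * Y * k⁻¹) - 1) i j‖ ^ 2) =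
      β (∑ i, ∑ j, ‖cayley (ζ⁻¹ • Y) i j‖ ^ 2) * χ (∑ i, ∑ j, ‖(ζ⁻¹ • Y - 1) i j‖ ^ 2) := by
  have hkdet : IsUnit k.det := Matrix.isUnit_det_of_right_inverse (Matrix.mem_unitaryGroup_iff.1 hk)
  have hsm : ζ⁻¹ • (k * Y * k⁻¹) = k * (ζ⁻¹ • Y) * k⁻¹ := by rw [Matrix.mul_smul, Matrix.smul_mul]
  have hsub : ζ⁻¹ • (k * Y * k⁻¹) - 1 = k * (ζ⁻¹ • Y - 1) * k⁻¹ := by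
    rw [hsm, Matrix.mul_sub, Matrix.sub_mul, Matrix.mul_one, Matrix.mul_nonsing_inv k hkdet]
  rw [hsub, sum_norm_sq_unitary_conj k hk, hsm, cayley_conj_eq k _ hkdet, sum_norm_sq_unitary_conj k hk]

/-- The Frobenius sum `Y ↦ Σ|M(Y)_{ij}|²` is smooth when `M` is (entries are continuous linear; `|·|²` is smooth on `ℂ`). [folklore] -/
private theorem contDiffAt_sum_norm_sq_comp {M : Matrix (Fin 3) (Fin 3) ℂ → Matrix (Fin 3) (Fin 3) ℂ} {Y : Matrix (Fin 3) (Fin 3) ℂ} {m : WithTop ℕ∞}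
    (hM : ContDiffAt ℝ m M Y) : ContDiffAt ℝ m (fun Y => ∑ i, ∑ j, ‖M Y i j‖ ^ 2) Y := by
  refine ContDiffAt.sum fun i _ => ContDiffAt.sum fun j _ => ?_
  have he : ContDiff ℝ m (fun N : Matrix (Fin 3) (Fin 3) ℂ => N i j) :=
    (LinearMap.toContinuousLinearMap (Matrix.entryLinearMap ℝ ℂ i j)).contDiff
  exact ((contDiff_norm_sq ℝ (n := m)).contDiffAt.comp _ (he.contDiffAt.comp _ hM))

/-- **AMBIENT SMOOTHNESS OF THE RADIAL CAYLEY BUMP** on all of `M₃(ℂ)`: `β`, `χ` smooth, `χ ≡ 0` on `[η, ∞)` with `η ≤ 1∕3` — on `{Σ|(ζ⁻¹Y − 1)_{ij}|² ≤ 1∕3}` the Cayley transform is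
smooth (§2: `1 + ζ⁻¹Y` is a unit, ★ `contDiffAt_cayley`), and off it the cut-off vanishes identically. [cite: Weyl1939, Ch. II §10] [cite: Knapp2002, Introduction §2] -/
theorem contDiff_radialCayleyBump (hβ : ContDiff ℝ ∞ β) (hχ : ContDiff ℝ ∞ χ) {η : ℝ} (hη3 : η ≤ 1 / 3) (hχ0 : ∀ s, η ≤ s → χ s = 0) :
    ContDiff ℝ ∞ fun Y : Matrix (Fin 3) (Fin 3) ℂ =>
      β (∑ i, ∑ j, ‖cayley (ζ⁻¹ • Y) i j‖ ^ 2) * χ (∑ i, ∑ j, ‖(ζ⁻¹ • Y - 1) i j‖ ^ 2) := by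
  have hX : ContDiff ℝ ∞ fun Y : Matrix (Fin 3) (Fin 3) ℂ => ζ⁻¹ • Y := contDiff_id.const_smul _
  have hq : ContDiff ℝ ∞ fun Y : Matrix (Fin 3) (Fin 3) ℂ => ∑ i, ∑ j, ‖(ζ⁻¹ • Y - 1) i j‖ ^ 2 :=
    contDiff_iff_contDiffAt.2 fun Y => contDiffAt_sum_norm_sq_comp (hX.sub contDiff_const).contDiffAt
  have hh : ContDiff ℝ ∞ fun Y : Matrix (Fin 3) (Fin 3) ℂ => χ (∑ i, ∑ j, ‖(ζ⁻¹ • Y - 1) i j‖ ^ 2) := hχ.comp hq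
  refine contDiff_iff_contDiffAt.2 fun Y => ?_
  by_cases hY : ∑ i, ∑ j, ‖(ζ⁻¹ • Y - 1) i j‖ ^ 2 ≤ 1 / 3
  · -- on the good set: `1 + ζ⁻¹Y` is a unit, everything is smooth
    have hU : IsUnit (1 + ζ⁻¹ • Y) := isUnit_one_add_of_sum_sq_sub_one_le _ hY
    have hc : ContDiffAt ℝ ∞ (fun Y : Matrix (Fin 3) (Fin 3) ℂ => cayley (ζ⁻¹ • Y)) Y :=
      (contDiffAt_cayley hU).comp Y hX.contDiffAt
    exact ((hβ.contDiffAt.comp Y (contDiffAt_sum_norm_sq_comp hc))).mul hh.contDiffAt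
  · -- off the good set: the cut-off vanishes on a neighbourhood
    have hlt : η < ∑ i, ∑ j, ‖(ζ⁻¹ • Y - 1) i j‖ ^ 2 := by linarith [lt_of_not_ge hY]
    have hev : ∀ᶠ Y' in 𝓝 Y, η < ∑ i, ∑ j, ‖(ζ⁻¹ • Y' - 1) i j‖ ^ 2 := hq.continuous.continuousAt.eventually_const_lt hlt
    have hzero : (fun Y : Matrix (Fin 3) (Fin 3) ℂ => β (∑ i, ∑ j, ‖cayley (ζ⁻¹ • Y) i j‖ ^ 2) * χ (∑ i, ∑ j, ‖(ζ⁻¹ • Y - 1) i j‖ ^ 2))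
        =ᶠ[𝓝 Y] fun _ => 0 := by
      filter_upwards [hev] with Y' hY'
      rw [hχ0 _ hY'.le, mul_zero]
    exact (contDiffAt_const (c := (0 : ℝ))).congr_of_eventuallyEq hzero

/-- **SMALL SUPPORT**: if `χ ≡ 0` on `[η, ∞)`, `0 < r` and `η ≤ r²∕9`, then `ψ(Y) ≠ 0 ⇒ ‖Y − ζ·1‖ < r` (`|ζ| = 1`; `‖X − 1‖ ≤ 9ε∕2 + Σ|(X−1)_{ij}|²∕(2ε)` with `ε = r∕9`).
[cite: Weyl1939, Ch. II §10] -/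
theorem norm_sub_lt_of_radialCayleyBump_ne_zero {η r : ℝ} (hχ0 : ∀ s, η ≤ s → χ s = 0) (hr : 0 < r) (hηr : η ≤ r ^ 2 / 9) (hζ : ‖ζ‖ = 1)
    {Y : Matrix (Fin 3) (Fin 3) ℂ}
    (hY : β (∑ i, ∑ j, ‖cayley (ζ⁻¹ • Y) i j‖ ^ 2) * χ (∑ i, ∑ j, ‖(ζ⁻¹ • Y - 1) i j‖ ^ 2) ≠ 0) :
    ‖Y - ζ • (1 : Matrix (Fin 3) (Fin 3) ℂ)‖ < r := by
  have hζ0 : ζ ≠ 0 := norm_ne_zero_iff.1 (by rw [hζ]; exact one_ne_zero)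
  have hq : ∑ i, ∑ j, ‖(ζ⁻¹ • Y - 1) i j‖ ^ 2 < η := by
    by_contra h
    exact hY (by rw [hχ0 _ (le_of_not_gt h), mul_zero])
  have e : Y - ζ • (1 : Matrix (Fin 3) (Fin 3) ℂ) = ζ • (ζ⁻¹ • Y - 1) := by
    rw [smul_sub, smul_smul, mul_inv_cancel₀ hζ0, one_smul]
  rw [e, norm_smul, hζ, one_mul]
  have h1 := linfty_opNorm_le_of_sum_sq (ζ⁻¹ • Y - 1) (ε := r / 9) (by positivity)
  have h2 : (∑ i, ∑ j, ‖(ζ⁻¹ • Y - 1) i j‖ ^ 2) / (2 * (r / 9)) < (r ^ 2 / 9) / (2 * (r / 9)) :=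
    div_lt_div_of_pos_right (by linarith) (by positivity)
  have h3 : (r ^ 2 / 9) / (2 * (r / 9)) = r / 2 := by field_simp
  have h4 : ((3 : ℕ) : ℝ) ^ 2 * (r / 9) / 2 = r / 2 := by norm_num; ring
  linarith

/-- **COMPACT SUPPORT INSIDE A PRESCRIBED NEIGHBOURHOOD**: with `η ≤ r²∕9` and `closedBall (ζ·1) r ⊆ U`, the bump has compact support and `tsupport ⊆ U`. [cite: Weyl1939, Ch. II §10] -/
theorem hasCompactSupport_radialCayleyBump {η r : ℝ} (hχ0 : ∀ s, η ≤ s → χ s = 0) (hr : 0 < r) (hηr : η ≤ r ^ 2 / 9) (hζ : ‖ζ‖ = 1)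
    {U : Set (Matrix (Fin 3) (Fin 3) ℂ)} (hU : closedBall (ζ • (1 : Matrix (Fin 3) (Fin 3) ℂ)) r ⊆ U) :
    HasCompactSupport (fun Y : Matrix (Fin 3) (Fin 3) ℂ =>
        β (∑ i, ∑ j, ‖cayley (ζ⁻¹ • Y) i j‖ ^ 2) * χ (∑ i, ∑ j, ‖(ζ⁻¹ • Y - 1) i j‖ ^ 2)) ∧
      tsupport (fun Y : Matrix (Fin 3) (Fin 3) ℂ =>
        β (∑ i, ∑ j, ‖cayley (ζ⁻¹ • Y) i j‖ ^ 2) * χ (∑ i, ∑ j, ‖(ζ⁻¹ • Y - 1) i j‖ ^ 2)) ⊆ U := by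
  have hsupp : Function.support (fun Y : Matrix (Fin 3) (Fin 3) ℂ =>
      β (∑ i, ∑ j, ‖cayley (ζ⁻¹ • Y) i j‖ ^ 2) * χ (∑ i, ∑ j, ‖(ζ⁻¹ • Y - 1) i j‖ ^ 2)) ⊆ ball (ζ • (1 : Matrix (Fin 3) (Fin 3) ℂ)) r :=
    fun Y hY => mem_ball_iff_norm.2 (norm_sub_lt_of_radialCayleyBump_ne_zero β χ ζ hχ0 hr hηr hζ hY)
  have hts : tsupport (fun Y : Matrix (Fin 3) (Fin 3) ℂ =>
      β (∑ i, ∑ j, ‖cayley (ζ⁻¹ • Y) i j‖ ^ 2) * χ (∑ i, ∑ j, ‖(ζ⁻¹ • Y - 1) i j‖ ^ 2)) ⊆ closedBall (ζ • (1 : Matrix (Fin 3) (Fin 3) ℂ)) r :=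
    (closure_mono hsupp).trans Metric.closure_ball_subset_closedBall
  exact ⟨HasCompactSupport.of_support_subset_isCompact (isCompact_closedBall _ _) (hsupp.trans ball_subset_closedBall), hts.trans hU⟩

/-- **ON `{1 + X invertible}` THE CUT-OFF IS INVISIBLE**: if `χ ≡ 1` on `(−∞, η∕2]`, `0 < η ≤ 1`, and `β ≡ 0` on `[R₀, ∞)` with `R₀ ≤ η²∕3600`, then for every `X` with `1 + X` a unit
`ψ(ζX) = β(Σ|c(X)_{ij}|²)` — the only place the profile is alive is where `X − 1` is small (§2). [cite: Weyl1939, Ch. II §10] -/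
theorem radialCayleyBump_smul_eq_of_isUnit {η R₀ : ℝ} (hη : 0 < η) (hη1 : η ≤ 1) (hχ1 : ∀ s, s ≤ η / 2 → χ s = 1) (hR₀ : R₀ ≤ η ^ 2 / 3600)
    (hβR : ∀ u, R₀ ≤ u → β u = 0) (hζ : ζ ≠ 0) (X : Matrix (Fin 3) (Fin 3) ℂ) (hX : IsUnit (1 + X)) :
    β (∑ i, ∑ j, ‖cayley (ζ⁻¹ • (ζ • X)) i j‖ ^ 2) * χ (∑ i, ∑ j, ‖(ζ⁻¹ • (ζ • X) - 1) i j‖ ^ 2) = β (∑ i, ∑ j, ‖cayley X i j‖ ^ 2) := by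
  rw [smul_smul, inv_mul_cancel₀ hζ, one_smul]
  by_cases hb : β (∑ i, ∑ j, ‖cayley X i j‖ ^ 2) = 0
  · rw [hb, zero_mul]
  have hlt : ∑ i, ∑ j, ‖cayley X i j‖ ^ 2 < R₀ := by
    by_contra h
    exact hb (hβR _ (le_of_not_gt h))
  have hsmall := sum_sq_sub_one_le_of_sum_sq_cayley_le X hX hη hη1 (by linarith)
  rw [hχ1 _ hsmall, mul_one]

end Bump

end Literature.NumberTheory.Automorphic.UnitaryGroup

end
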